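import Summits.QuantumFields.YangMills.Theorems.VirialFluxGapRingFrameLog
import Summits.QuantumFields.YangMills.Theorems.VirialFluxGapRingFrameBlockCalculus
import HarnessLib

/-!
# Route `VirialFluxGap` (YangMills): LOG-COORDINATE VELOCITIES of curves in the ring group (toward the kernel family of the resolvent Euler field)

Toward the deciding crux `VirialFluxGap.PeriodicSoftness` (item stmt-QuantumFields-24141), generic-region Euler field (memo v2, input (iii) = (K)).
✓`FrameHessian.hess_mulVec_eq_zero_of_valley_curve` turns a family of zeros `p·exp(Σ u(s)_jτ_j)` with `s⁻¹u(s) → v` into a kernel vector `v` of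
the frame Hessian at `p`.  This file identifies `v` for the STANDARD coordinates of the slot logarithms of a differentiable curve `q(s)` through
`p` — so a taker of (K) only has to exhibit curves INSIDE the valley with known slot velocities (gauge ∕ moduli ∕ comb curves) and check linear
independence of the resulting vectors:

* §1 ★ `norm_mlog_sub_sub_one_le` — the quadratic remainder of Bałaban's matrix logarithm: `‖log X − (X − 1)‖ ≤ 2‖X − 1‖²` for `‖X − 1‖ ≤ ½`;
* §2 ★★ `tendsto_inv_smul_mlog` — if `s ↦ X(s)` is differentiable at `0` with `X(0) = 1` and derivative `V`, then `s⁻¹·log X(s) → V`;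
* §3 ★★ `tendsto_inv_smul_stdCoord_log` — for a curve of ring histories `q(s)` with `q(0) = p` whose slots are differentiable at `0` with
  velocities `V_w`, the standard coordinates `u(s) = stdCoord(w ↦ log(p_wᴴ q(s)_w))` satisfy `s⁻¹·u(s) → stdCoord(w ↦ p_wᴴV_w)`.

HONEST FRAMING: helper calculus; the valley curves themselves and the independence count (K) are NOT here; ⟨24141⟩ stays OPEN; no stub / crux /
rung / summit is closed; the Yang–Mills mass gap is NOT proved; no summit is proved by a line.  THEOREMS ONLY (0 `def`, 0 `sorry`), standard
axioms.  Explicit-unit seat `ym-line-fcl-p3` g40 (cell ym-idea-1, free hands), `--supports stmt-QuantumFields-24141`.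
References: [cite: Balaban1985Averaging, (21), (26) p. 21–22]; [folklore].
-/

set_option autoImplicit false

noncomputable section

open scoped Matrix BigOperators ContDiff Topology
open MeasureTheory Set Matrix Filter
open Literature.MathematicalPhysics.QuantumFieldTheory hiding SU2
open Literature.MathematicalPhysics.QuantumLattice
open Literature.MathematicalPhysics.QuantumFieldTheory.SUNBakryEmery (expSU coe_expSU matTop)
open Literature.MathematicalPhysics.QuantumFieldTheory.Balaban1983to89.MatrixLog (mlog hasSum_mlog)
open Literature.Analysis.Complex (logSeriesCoeff norm_logSeriesCoeff_le)

namespace Summit.QuantumFields.YangMills.Theorems.VirialFluxGap.FrameHessian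

open Summit.QuantumFields.YangMills.Theorems.FemtoTransferGap
open Summit.QuantumFields.YangMills.Theorems.FemtoTransferGap.TT
open Summit.QuantumFields.YangMills.Theorems.VirialFluxGap.RingDeficit
open Summit.QuantumFields.YangMills.Theorems.VirialFluxGap.FrameDerivative

open scoped Matrix.Norms.Frobenius

attribute [local instance 2000] Literature.MathematicalPhysics.QuantumFieldTheory.SUNBakryEmery.matTop

/-! ## §1 The quadratic remainder of the matrix logarithm -/

/-- ★ `‖log X − (X − 1)‖ ≤ 2‖X − 1‖²` for `‖X − 1‖_F ≤ ½` (tail of the logarithmic series (21) from `n = 2`, coefficients `|c_n| ≤ 1`).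
[cite: Balaban1985Averaging, (21), (26) p. 21–22] -/
theorem norm_mlog_sub_sub_one_le {X : Matrix (Fin 2) (Fin 2) ℂ} (hX : ‖X - 1‖ ≤ 1 / 2) :
    ‖mlog X - (X - 1)‖ ≤ 2 * ‖X - 1‖ ^ 2 := by
  set y : Matrix (Fin 2) (Fin 2) ℂ := X - 1 with hy
  have hy1 : ‖y‖ < 1 := by rw [hy]; linarith
  have hsum := hasSum_mlog (show ‖X - 1‖ < 1 by linarith)
  -- split off the terms `n = 0, 1`: `c₀ = 0`, `c₁ • y = y`
  have htail : HasSum (fun n : ℕ => logSeriesCoeff (n + 2) • y ^ (n + 2)) (mlog X - y) := by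
    have h := (hasSum_nat_add_iff' 2).2 hsum
    have e : ∑ i ∈ Finset.range 2, logSeriesCoeff i • (X - 1) ^ i = y := by
      rw [Finset.sum_range_succ, Finset.sum_range_succ, Finset.sum_range_zero, zero_add]
      simp [logSeriesCoeff, hy]
    rw [e] at h
    exact h
  -- compare with the geometric tail `‖y‖^{n+2}`
  have hgeom : HasSum (fun n : ℕ => ‖y‖ ^ (n + 2)) (‖y‖ ^ 2 * (1 - ‖y‖)⁻¹) := by
    have h := (hasSum_geometric_of_lt_one (norm_nonneg y) hy1).mul_left (‖y‖ ^ 2)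
    refine h.congr_fun fun n => ?_
    ring
  have hle : ∀ n : ℕ, ‖logSeriesCoeff (n + 2) • y ^ (n + 2)‖ ≤ ‖y‖ ^ (n + 2) := fun n => by
    rw [norm_smul]
    calc ‖logSeriesCoeff (n + 2)‖ * ‖y ^ (n + 2)‖ ≤ 1 * ‖y‖ ^ (n + 2) :=
        mul_le_mul (norm_logSeriesCoeff_le _) (norm_pow_le' y (by omega)) (norm_nonneg _) zero_le_one
      _ = ‖y‖ ^ (n + 2) := one_mul _
  have hbound : ‖mlog X - y‖ ≤ ‖y‖ ^ 2 * (1 - ‖y‖)⁻¹ :=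
    htail.norm_le_of_bounded hgeom hle
  have hinv : (1 - ‖y‖)⁻¹ ≤ 2 := by
    rw [inv_le_comm₀ (by linarith) (by norm_num)]; rw [hy] at *; linarith
  calc ‖mlog X - y‖ ≤ ‖y‖ ^ 2 * (1 - ‖y‖)⁻¹ := hbound
    _ ≤ ‖y‖ ^ 2 * 2 := mul_le_mul_of_nonneg_left hinv (sq_nonneg _)
    _ = 2 * ‖X - 1‖ ^ 2 := by rw [hy]; ring

/-! ## §2 The logarithm of a differentiable curve through `1` -/

/-- ★★ If `X(s)` is differentiable at `0` with `X(0) = 1` and derivative `V`, then `s⁻¹·log X(s) → V` (`s → 0`, `s ≠ 0`). [folklore] -/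
theorem tendsto_inv_smul_mlog {X : ℝ → Matrix (Fin 2) (Fin 2) ℂ} {V : Matrix (Fin 2) (Fin 2) ℂ} (hX0 : X 0 = 1) (hX : HasDerivAt X V 0) :
    Tendsto (fun s : ℝ => s⁻¹ • mlog (X s)) (𝓝[≠] (0 : ℝ)) (𝓝 V) := by
  -- the slope of `X` tends to `V`
  have hslope : Tendsto (fun s : ℝ => s⁻¹ • (X s - 1)) (𝓝[≠] (0 : ℝ)) (𝓝 V) := by
    have h := hX.tendsto_slope_zero
    simp only [zero_add, hX0] at h
    exact h
  -- the remainder `s⁻¹ (log X(s) − (X(s) − 1))` tends to `0`: `≤ 2|s|⁻¹‖X(s) − 1‖² = 2|s|·‖s⁻¹(X(s)−1)‖²`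
  have hcont : Tendsto X (𝓝[≠] (0 : ℝ)) (𝓝 1) := by
    have := hX.continuousAt.tendsto
    rw [hX0] at this
    exact this.mono_left nhdsWithin_le_nhds
  have hsmall : ∀ᶠ s in 𝓝[≠] (0 : ℝ), ‖X s - 1‖ ≤ 1 / 2 := by
    have : ∀ᶠ s in 𝓝[≠] (0 : ℝ), X s ∈ Metric.closedBall (1 : Matrix (Fin 2) (Fin 2) ℂ) (1 / 2) :=
      hcont (Metric.closedBall_mem_nhds _ (by norm_num))
    filter_upwards [this] with s hs
    rwa [Metric.mem_closedBall, dist_eq_norm] at hs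
  have hrem : Tendsto (fun s : ℝ => s⁻¹ • (mlog (X s) - (X s - 1))) (𝓝[≠] (0 : ℝ)) (𝓝 0) := by
    have hb : Tendsto (fun s : ℝ => 2 * |s| * ‖s⁻¹ • (X s - 1)‖ ^ 2) (𝓝[≠] (0 : ℝ)) (𝓝 0) := by
      have h1 : Tendsto (fun s : ℝ => 2 * |s|) (𝓝[≠] (0 : ℝ)) (𝓝 0) := by
        have : Tendsto (fun s : ℝ => 2 * |s|) (𝓝 (0 : ℝ)) (𝓝 (2 * |0|)) := (continuous_const.mul continuous_abs).tendsto 0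
        rw [abs_zero, mul_zero] at this
        exact this.mono_left nhdsWithin_le_nhds
      have h2 : Tendsto (fun s : ℝ => ‖s⁻¹ • (X s - 1)‖ ^ 2) (𝓝[≠] (0 : ℝ)) (𝓝 (‖V‖ ^ 2)) := (hslope.norm).pow 2
      have := h1.mul h2
      rw [zero_mul] at this
      exact this
    refine squeeze_zero_norm' ?_ hb
    filter_upwards [hsmall, self_mem_nhdsWithin] with s hs hs0
    have hs0' : s ≠ 0 := hs0
    rw [norm_smul, norm_inv, Real.norm_eq_abs]
    have hq := norm_mlog_sub_sub_one_le hs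
    have e : ‖s⁻¹ • (X s - 1)‖ ^ 2 = |s|⁻¹ ^ 2 * ‖X s - 1‖ ^ 2 := by
      rw [norm_smul, norm_inv, Real.norm_eq_abs, mul_pow]
    rw [e]
    have hspos : 0 < |s| := abs_pos.2 hs0'
    calc |s|⁻¹ * ‖mlog (X s) - (X s - 1)‖ ≤ |s|⁻¹ * (2 * ‖X s - 1‖ ^ 2) :=
        mul_le_mul_of_nonneg_left hq (inv_nonneg.2 hspos.le)
      _ = 2 * |s| * (|s|⁻¹ ^ 2 * ‖X s - 1‖ ^ 2) := by field_simp
  have := hslope.add hrem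
  rw [add_zero] at this
  refine this.congr fun s => ?_
  rw [← smul_add, add_sub_cancel]

/-! ## §3 Standard coordinates of the slot logarithms of a curve of ring histories -/

variable {L : ℕ} [NeZero L]

/-- The half-Pauli coordinates are continuous linear in the matrix (used coordinatewise). [folklore] -/
theorem tendsto_pauliCoord {α : Type*} {l : Filter α} {F : α → Matrix (Fin 2) (Fin 2) ℂ} {A : Matrix (Fin 2) (Fin 2) ℂ}
    (h : Tendsto F l (𝓝 A)) (a : Fin 3) : Tendsto (fun x => pauliCoord (F x) a) l (𝓝 (pauliCoord A a)) := by
  have hc : Continuous fun B : Matrix (Fin 2) (Fin 2) ℂ => pauliCoord B a := by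
    fin_cases a
    · exact continuous_const.mul (Complex.continuous_im.comp ((continuous_apply 1).comp (continuous_apply 0)))
    · exact continuous_const.mul (Complex.continuous_re.comp ((continuous_apply 1).comp (continuous_apply 0)))
    · exact continuous_const.mul (Complex.continuous_im.comp ((continuous_apply 0).comp (continuous_apply 0)))
  exact (hc.tendsto A).comp h

/-- The half-Pauli coordinates are homogeneous. [folklore] -/
theorem pauliCoord_smul (r : ℝ) (B : Matrix (Fin 2) (Fin 2) ℂ) (a : Fin 3) : pauliCoord (r • B) a = r * pauliCoord B a := by
  fin_cases a <;> simp [pauliCoord, Matrix.smul_apply] <;> ring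

/-- ★★ **Log-coordinate velocity of a curve of ring histories.**  Let `q : ℝ → Ω_L` with `q 0 = p` have every slot differentiable at `0` (as a
matrix curve) with velocity `V_w`.  Then the standard coordinates of the slot logarithms, `u(s) = stdCoord(w ↦ log(p_wᴴ·q(s)_w))`, satisfy
`s⁻¹·u(s) → stdCoord(w ↦ p_wᴴ V_w)` — the `v` of ✓`hess_mulVec_eq_zero_of_valley_curve` when `q(s)` stays in the zero set. [folklore] -/
theorem tendsto_inv_smul_stdCoord_log (p : ((Fin (2 * L - 1 + 1) → GaugeConfig 3 L SU2) × (Site 3 L → SU2))) (q : ℝ → ((Fin (2 * L - 1 + 1) → GaugeConfig 3 L SU2) × (Site 3 L → SU2))) (hq0 : q 0 = p) (V : ((Fin (2 * L - 1 + 1) × Edge 3 L) ⊕ Site 3 L) → Matrix (Fin 2) (Fin 2) ℂ)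
    (hq : ∀ w : ((Fin (2 * L - 1 + 1) × Edge 3 L) ⊕ Site 3 L), HasDerivAt (fun s => coordAt w (ringCoord L (q s))) (V w) 0) :
    Tendsto (fun s : ℝ => s⁻¹ • stdCoord (L := L) (fun w => mlog ((coordAt w (ringCoord L p))ᴴ * coordAt w (ringCoord L (q s)))))
      (𝓝[≠] (0 : ℝ)) (𝓝 (stdCoord (L := L) fun w => (coordAt w (ringCoord L p))ᴴ * V w)) := by
  rw [tendsto_pi_nhds]
  rintro ⟨w, a⟩
  -- the slot curve `X(s) = p_wᴴ q(s)_w` through `1` with velocity `p_wᴴ V_w`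
  have hunit : (coordAt w (ringCoord L p))ᴴ * coordAt w (ringCoord L p) = 1 := by
    have hmem : coordAt w (ringCoord L p) ∈ Matrix.unitaryGroup (Fin 2) ℂ := by
      unfold coordAt ringCoord
      rcases w with ⟨i, e⟩ | x
      · exact (Matrix.mem_specialUnitaryGroup_iff.mp (p.1 i e).2).1
      · exact (Matrix.mem_specialUnitaryGroup_iff.mp (p.2 x).2).1
    rw [← Matrix.star_eq_conjTranspose]; exact Matrix.mem_unitaryGroup_iff'.1 hmem
  have hX0 : (coordAt w (ringCoord L p))ᴴ * coordAt w (ringCoord L (q 0)) = 1 := by rw [hq0]; exact hunit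
  have hX : HasDerivAt (fun s => (coordAt w (ringCoord L p))ᴴ * coordAt w (ringCoord L (q s))) ((coordAt w (ringCoord L p))ᴴ * V w) 0 :=
    (hq w).const_mul _
  have hlog := tendsto_inv_smul_mlog hX0 hX
  have h := tendsto_pauliCoord hlog a
  simp only [Pi.smul_apply, stdCoord, smul_eq_mul]
  refine h.congr fun s => ?_
  rw [pauliCoord_smul]

end Summit.QuantumFields.YangMills.Theorems.VirialFluxGap.FrameHessian

end
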